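import Summits.QuantumFields.YangMills.Theorems.BalabanUVNodesN15PerCubeGreenNodeObjects
import HarnessLib

/-!
# N15 = NE2, road (c) — PROGRAMME (PC), (PC-E-J-N): THE NODE OBJECTS OF THE GRADIENT ENTRY — ENTRY 1 OF (3.42) IN A DIRECTION `μ₀` FOR THE NAMED SCALAR COVARIANT GREEN's FUNCTION
# FAMILY ON THE PRINTED PER-CUBE CLASS: `pcEntry1 μ₀` = the two-grid η-defect through `τ_{Ad∘U′}` of `D_{U′,μ₀}∘(Δ_{R_U′} + a′Q′_TᵀQ′_T)⁻¹` against `D_{U,μ₀}∘(Δ_{R_U} + aQ′_TᵀQ′_T)⁻¹`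
# (n15-c∕420's operator VERBATIM), the operator quadruple `pcOps₁ μ₀ E` with entries 0, 1, 3 CONSTRUCTED (entry 2 the consumer's) and its kernel family `pcFamily₁` (dag-n15-c g36, n15-c∕421)

Cell `pub-ymgap`, seat `pub-ymgap-dag-n15-c` (generation g36; R134 (a) seat, strategy s1 «first missing estimate»; HUMAN RULING D-0062; chair R424 venue).
`bears_on: R4∕N15 · K3⁸ SpineGivenEndpointR13SepCoPHV (stmt-QuantumFields-27366)`; filed `--kind definition --supports stmt-QuantumFields-27366 --as helper` — COUNT-NEUTRAL
(definitions: reviewed ∕ async-audit lane).  3 `def` + 6 `rfl` lemmas; 0 `sorry`, 0 `instance`.  Imports BY NAME n15-c∕397 `…PerCubeGreenNodeObjects` (`PcIdx`, `pcGeo`, `pcBgF`, `pcPairing`,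
`pcInstance`, `pcEntry0`, `pcEntry3`, and through it `scGreenOp(′)`, the (PC) site carriers, `ctauS`, `kingSec`, `mprod`, n15-b `opGeo`∕`opFamily`, `MatrixSpecies.covD`).  Nothing in the tree is
modified, no landed name re-declared; generator `tools/build_E.py` (the entry operator is CUT VERBATIM from n15-c∕417's conclusion, indices `m k r ↦ i.mv i.kk i.r`).

WHAT (objects for n15-c∕422's `NE2PlusOperator` readout with entry 1 constructed from n15-c∕420 `uN_idef_covD_scGreenOp_of_reg910_rate`):
* `pcEntry1 … i μ₀ U′` — ENTRY 1 OF [B9] (3.42) (`∇_U G′`) IN THE DIRECTION `μ₀`, at two spacings: `𝔇_{τ_{Ad∘U′}}(D_{U′,μ₀} ∘ scGreenOp′ … U′, D_{U,μ₀} ∘ scGreenOp … U)` — n15-b's matrix covariant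
  derivative `MatrixSpecies.covD η (Ad∘U_{μ₀}) (·+e_{μ₀})` of the raw fields composed with THE named inverses (n15-c∕388) at King's masses `a_K(a₀,L,·)·n^{d+1}`, `U` = the straight fine
  holonomies of `U′` along King's block lines.  One operator per direction: the family's fine test space is the fixed `ScX′ × ι → ℝ`, so the gradient's `d+1` components are read one
  direction at a time (the sup over `μ₀` of the block norms is the gradient's block norm up to `d+1`);
* `pcOps₁ … i μ₀ E` — THE FOUR ENTRY OPERATORS with entries 0 (`pcEntry0`), 1 (`pcEntry1 μ₀`), 3 (`pcEntry3`) constructed and entry 2 (`G′∇*_U`, the adjoint arrangement — not in the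
  tree on the per-cube class) the consumer's `E 2`; unfolding lemmas `pcOps₁_zero∕one∕two∕three`;
* `pcFamily₁ … i μ₀ E` — n15-b `opFamily` of `pcOps₁` on the coloured (PC) site carriers (397's `pcFamily` with `pcOps ↦ pcOps₁`); `pcFamily₁_e` (unfolding).

HONEST FRAMING ∕ LIMITS.  Plumbing only (definitions + `rfl` lemmas); MODEL carriers ∕ class ∕ pairing ∕ operators as in the (PC) chain (King's doubled-torus cover model, one cube scale
`ξ = 1`, the (3.35) constant tied to the size parameter `M = L^m` of the cover's cubes); nothing of [B9]∕[B11] asserted; NE2⁺ NOT PRINTED, NOT proved; N15 of record untouched (DISCHARGED AS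
CONSUMED, p687738); K3⁸ OPEN; counts of record UNMOVED (typed 28∕28 · discharged 8∕27); one finite 𝕋⁴ at fixed ε per index — NOT infinite volume, NOT OS on ℝ⁴, NOT a mass gap, NOT Clay.
Restate-immune (no Theses import).
-/

set_option autoImplicit false

noncomputable section

open scoped BigOperators Matrix Matrix.Norms.L2Operator

namespace Summit.QuantumFields.YangMills.BalabanUVNodes.N15.Gluing

open Literature.MathematicalPhysics.QuantumFieldTheory.Balaban1983to89
open Literature.MathematicalPhysics.QuantumFieldTheory.Balaban1983to89.B5Prop11Plancherel (Tor fine unitVec)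
open Literature.MathematicalPhysics.QuantumFieldTheory.Balaban1983to89.T4EtaRate (PairedInstance EtaPairing)
open Literature.MathematicalPhysics.QuantumFieldTheory.Balaban1983to89.T4EtaRateDefect (idef)
open Literature.MathematicalPhysics.QuantumFieldTheory.Balaban1983to89.T4EtaRateCoeffDefect (pull)
open Literature.MathematicalPhysics.QuantumFieldTheory.Balaban1983to89.B11SectG (BlockNorm)
open Literature.MathematicalPhysics.QuantumFieldTheory.Balaban1983to89.B6UnitTorusCarrier (unitTorusGeo)
open Literature.MathematicalPhysics.QuantumFieldTheory.King1986 (aK)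
open Literature.MathematicalPhysics.QuantumFieldTheory.King1986.Torus (tdistT)
open Summit.QuantumFields.YangMills.BalabanUVNodes.N15.BackgroundLayer (covLapM fineGeo bgInstanceM₂R)
open Summit.QuantumFields.YangMills.BalabanUVNodes.N15.VectorPiece (kingPr unitTorusGeoS)
open Summit.QuantumFields.YangMills.BalabanUVNodes.N15.MatrixSpecies (coordMat liftMap liftBlk covD)
open Summit.QuantumFields.YangMills.BalabanUVNodes.N15.CurvedSpecies (gaugePair)
open Summit.QuantumFields.YangMills.BalabanUVNodes.N15.CovAvg (mprod mprod_one kingSec ctauS)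
open Summit.QuantumFields.YangMills.BalabanUVNodes.N15.OperatorReadout (opGeo opFamily)

variable {d : ℕ}

section Family

variable (d) {L : ℕ} [NeZero L] (mm ι : Type) [Fintype mm] [DecidableEq mm] [Fintype ι] [DecidableEq ι] (a₀ : ℝ) (e : Matrix mm mm ℂ ≃L[ℝ] (ι → ℝ)) (c₄r β₀ : ℝ)

/-- ★ **ENTRY 1 OF THE NAMED FAMILY IN THE DIRECTION `μ₀`** (`∇_U G′` of [B9] (3.42), one component): the η-defect through the covariant transport `τ_{Ad∘U′}` between
`D_{U′,μ₀} ∘ scGreenOp′ … U′` (THE fine named Green's function `(Δ_{R_U′} + a′Q′_TᵀQ′_T)⁻¹`, King's mass `a_K(a₀,L,r+k)·(L^rL^k)^{d+1}`, preceded by n15-b's matrix covariant derivative of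
the raw field `U′_{μ₀}`) and `D_{U,μ₀} ∘ scGreenOp … U` at the straight holonomies `U` of `U′` — n15-c∕417∕420's operator VERBATIM.
[cite: Balaban1985BackgroundPropagators, (3.42) p.397 (second entry `∇_U G′`: shape), (3.24)–(3.25) p.394, Thm 3.14 pp.426–427 (difference template)] -/
def pcEntry1 (hL : Odd L ∧ 1 < L) (i : PcIdx d L) (μ₀ : Fin (d + 1)) (U' : Fin (d + 1) → ScX' d L i.mv i.kk i.r hL → (Matrix mm mm ℂ)ˣ) :
    (ScX d L i.mv i.kk hL × ι → ℝ) →ₗ[ℝ] (ScX' d L i.mv i.kk i.r hL × ι → ℝ) :=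
  idef (ctauS (cvM d L i.mv i.kk hL) L i.kk i.r (fun μ x' => coordMat e (ContinuousLinearMap.mulLeftRight ℝ (Matrix mm mm ℂ) ((U' μ x' : Matrix mm mm ℂ)) ((U' μ x' : Matrix mm mm ℂ))ᴴ))) (ctauS (cvM d L i.mv i.kk hL) L i.kk i.r (fun μ x' => coordMat e (ContinuousLinearMap.mulLeftRight ℝ (Matrix mm mm ℂ) ((U' μ x' : Matrix mm mm ℂ)) ((U' μ x' : Matrix mm mm ℂ))ᴴ)))
    (covD ((((L ^ i.r * L ^ i.kk : ℕ) : ℝ))⁻¹) (fun x' => coordMat e (ContinuousLinearMap.mulLeftRight ℝ (Matrix mm mm ℂ) ((U' μ₀ x' : Matrix mm mm ℂ)) ((U' μ₀ x' : Matrix mm mm ℂ))ᴴ)) (scShift' d L i.mv i.kk i.r hL μ₀) ∘ₗ scGreenOp' d L i.mv i.kk i.r hL (aK a₀ (L : ℝ) (i.r + i.kk) * (((L ^ i.r * L ^ i.kk : ℕ) : ℝ)) ^ (d + 1)) ((((L ^ i.r * L ^ i.kk : ℕ) : ℝ))⁻¹) ι e (fun μ z => (U' μ z : Matrix mm mm 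ℂ)))
    (covD ((((L ^ i.kk : ℕ) : ℝ))⁻¹) (fun x => coordMat e (ContinuousLinearMap.mulLeftRight ℝ (Matrix mm mm ℂ) ((fun μ y => mprod (fun t => (U' μ (kingSec (cvM d L i.mv i.kk hL) L i.kk i.r y + t • unitVec (fine (L ^ i.r * L ^ i.kk) (cvM d L i.mv i.kk hL)) μ) : Matrix mm mm ℂ)) (L ^ i.r)) μ₀ x) ((fun μ y => mprod (fun t => (U' μ (kingSec (cvM d L i.mv i.kk hL) L i.kk i.r y + t • unitVec (fine (L ^ i.r * L ^ i.kk) (cvM d L i.mv i.kk hL)) μ) : Matrix mm mm ℂ)) (L ^ i.r)) μ₀ x)ᴴ)) (scShift d L i.mv i.kk hL μ₀) ∘ₗ scGreenOp d L i.mv i.kk hL (aK a₀ (L : ℝ) i.kk * (((L ^ i.kk : ℕ) : ℝ)) ^ (d + 1)) ((((L ^ i.kk : ℕ) : ℝ))⁻¹) ι e (fun μ y => mprod (fun t => (U' μ (kingSec (cvM d L i.mv i.kk hL) L i.kk i.r y + t • unitVec (fine (L ^ i.r * L ^ i.kk) (cvM d L i.mv i.kk hL)) μ) : Matrix mm mm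 ℂ)) (L ^ i.r)))

/-- THE FOUR ENTRY OPERATORS WITH THE GRADIENT ENTRY CONSTRUCTED: entry 0 = `pcEntry0`, entry 1 = `pcEntry1 μ₀`, entry 3 = `pcEntry3`; entry 2 (`G′∇*_U`, the adjoint arrangement) = the
consumer's `E 2` (its two-grid jet edition on the per-cube class is not in the tree). [cite: Balaban1985BackgroundPropagators, (3.42) p.397 (the four entries: shape)] -/
def pcOps₁ (hL : Odd L ∧ 1 < L) (i : PcIdx d L) (μ₀ : Fin (d + 1))
    (E : Fin 4 → (Fin (d + 1) → ScX' d L i.mv i.kk i.r hL → (Matrix mm mm ℂ)ˣ) → ((ScX d L i.mv i.kk hL × ι → ℝ) →ₗ[ℝ] (ScX' d L i.mv i.kk i.r hL × ι → ℝ))) :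
    Fin 4 → (Fin (d + 1) → ScX' d L i.mv i.kk i.r hL → (Matrix mm mm ℂ)ˣ) → ((ScX d L i.mv i.kk hL × ι → ℝ) →ₗ[ℝ] (ScX' d L i.mv i.kk i.r hL × ι → ℝ)) :=
  fun n U' => ![pcEntry0 d mm ι a₀ e hL i U', pcEntry1 d mm ι a₀ e hL i μ₀ U', E 2 U', pcEntry3 d mm ι a₀ e hL i U'] n

/-- Unfolding: entry 0. [folklore] -/
@[simp] theorem pcOps₁_zero (hL : Odd L ∧ 1 < L) (i : PcIdx d L) (μ₀ : Fin (d + 1))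
    (E : Fin 4 → (Fin (d + 1) → ScX' d L i.mv i.kk i.r hL → (Matrix mm mm ℂ)ˣ) → ((ScX d L i.mv i.kk hL × ι → ℝ) →ₗ[ℝ] (ScX' d L i.mv i.kk i.r hL × ι → ℝ)))
    (U' : Fin (d + 1) → ScX' d L i.mv i.kk i.r hL → (Matrix mm mm ℂ)ˣ) : pcOps₁ d mm ι a₀ e hL i μ₀ E 0 U' = pcEntry0 d mm ι a₀ e hL i U' := rfl

/-- Unfolding: entry 1 is THE CONSTRUCTED gradient entry in the direction `μ₀`. [folklore] -/
@[simp] theorem pcOps₁_one (hL : Odd L ∧ 1 < L) (i : PcIdx d L) (μ₀ : Fin (d + 1))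
    (E : Fin 4 → (Fin (d + 1) → ScX' d L i.mv i.kk i.r hL → (Matrix mm mm ℂ)ˣ) → ((ScX d L i.mv i.kk hL × ι → ℝ) →ₗ[ℝ] (ScX' d L i.mv i.kk i.r hL × ι → ℝ)))
    (U' : Fin (d + 1) → ScX' d L i.mv i.kk i.r hL → (Matrix mm mm ℂ)ˣ) : pcOps₁ d mm ι a₀ e hL i μ₀ E 1 U' = pcEntry1 d mm ι a₀ e hL i μ₀ U' := rfl

/-- Unfolding: entry 2 is the consumer's. [folklore] -/
theorem pcOps₁_two (hL : Odd L ∧ 1 < L) (i : PcIdx d L) (μ₀ : Fin (d + 1))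
    (E : Fin 4 → (Fin (d + 1) → ScX' d L i.mv i.kk i.r hL → (Matrix mm mm ℂ)ˣ) → ((ScX d L i.mv i.kk hL × ι → ℝ) →ₗ[ℝ] (ScX' d L i.mv i.kk i.r hL × ι → ℝ)))
    (U' : Fin (d + 1) → ScX' d L i.mv i.kk i.r hL → (Matrix mm mm ℂ)ˣ) : pcOps₁ d mm ι a₀ e hL i μ₀ E 2 U' = E 2 U' := rfl

/-- Unfolding: entry 3. [folklore] -/
@[simp] theorem pcOps₁_three (hL : Odd L ∧ 1 < L) (i : PcIdx d L) (μ₀ : Fin (d + 1))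
    (E : Fin 4 → (Fin (d + 1) → ScX' d L i.mv i.kk i.r hL → (Matrix mm mm ℂ)ˣ) → ((ScX d L i.mv i.kk hL × ι → ℝ) →ₗ[ℝ] (ScX' d L i.mv i.kk i.r hL × ι → ℝ)))
    (U' : Fin (d + 1) → ScX' d L i.mv i.kk i.r hL → (Matrix mm mm ℂ)ˣ) : pcOps₁ d mm ι a₀ e hL i μ₀ E 3 U' = pcEntry3 d mm ι a₀ e hL i U' := rfl

/-- `pcOps₁` is 397's `pcOps` at the quadruple whose entry 1 is `pcEntry1 μ₀` (so every fact about `pcOps`∕`pcFamily` transfers). [folklore] -/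
theorem pcOps₁_eq_pcOps (hL : Odd L ∧ 1 < L) (i : PcIdx d L) (μ₀ : Fin (d + 1))
    (E : Fin 4 → (Fin (d + 1) → ScX' d L i.mv i.kk i.r hL → (Matrix mm mm ℂ)ˣ) → ((ScX d L i.mv i.kk hL × ι → ℝ) →ₗ[ℝ] (ScX' d L i.mv i.kk i.r hL × ι → ℝ))) :
    pcOps₁ d mm ι a₀ e hL i μ₀ E = pcOps d mm ι a₀ e hL i (Function.update E 1 (pcEntry1 d mm ι a₀ e hL i μ₀)) := by
  funext n U'
  fin_cases n <;> rfl

/-- THE KERNEL FAMILY of the index with the gradient entry constructed (n15-b `opFamily` of `pcOps₁` on the coloured (PC) site carriers: coarse blocks `liftBlk scBlk ι`, fine blocks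
through King's block map). [cite: Balaban1985BackgroundPropagators, (3.42) p.397 (shape)] -/
def pcFamily₁ (hL : Odd L ∧ 1 < L) (i : PcIdx d L) (μ₀ : Fin (d + 1))
    (E : Fin 4 → (Fin (d + 1) → ScX' d L i.mv i.kk i.r hL → (Matrix mm mm ℂ)ˣ) → ((ScX d L i.mv i.kk hL × ι → ℝ) →ₗ[ℝ] (ScX' d L i.mv i.kk i.r hL × ι → ℝ))) :
    B9.KernelFamily (pcInstance d mm ι c₄r β₀ hL i).gc (pcInstance d mm ι c₄r β₀ hL i).Bf :=
  show B9.KernelFamily (opGeo (pcGeo d hL i) (ScX d L i.mv i.kk hL × ι) (liftBlk (scBlk d L i.mv i.kk hL) ι)) (pcBgF d L mm i.mv i.kk i.r hL ((L : ℝ) ^ i.mv) c₄r β₀) from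
    opFamily (g := pcGeo d hL i) (liftBlk (scBlk d L i.mv i.kk hL) ι) (liftBlk (scBlk d L i.mv i.kk hL ∘ kingPr L i.kk i.r (cvM d L i.mv i.kk hL)) ι) (pcOps₁ d mm ι a₀ e hL i μ₀ E)

/-- `pcFamily₁` is 397's `pcFamily` at the updated quadruple. [folklore] -/
theorem pcFamily₁_eq_pcFamily (hL : Odd L ∧ 1 < L) (i : PcIdx d L) (μ₀ : Fin (d + 1))
    (E : Fin 4 → (Fin (d + 1) → ScX' d L i.mv i.kk i.r hL → (Matrix mm mm ℂ)ˣ) → ((ScX d L i.mv i.kk hL × ι → ℝ) →ₗ[ℝ] (ScX' d L i.mv i.kk i.r hL × ι → ℝ))) :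
    pcFamily₁ d mm ι a₀ e c₄r β₀ hL i μ₀ E = pcFamily d mm ι a₀ e c₄r β₀ hL i (Function.update E 1 (pcEntry1 d mm ι a₀ e hL i μ₀)) := by
  unfold pcFamily₁ pcFamily
  rw [pcOps₁_eq_pcOps]

/-- Unfolding of the entries: the sharp fine-cube sup of the entry operator applied to the test function. [folklore] -/
theorem pcFamily₁_e (hL : Odd L ∧ 1 < L) (i : PcIdx d L) (μ₀ : Fin (d + 1))
    (E : Fin 4 → (Fin (d + 1) → ScX' d L i.mv i.kk i.r hL → (Matrix mm mm ℂ)ˣ) → ((ScX d L i.mv i.kk hL × ι → ℝ) →ₗ[ℝ] (ScX' d L i.mv i.kk i.r hL × ι → ℝ)))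
    (n : Fin 4) (U' : Fin (d + 1) → ScX' d L i.mv i.kk i.r hL → (Matrix mm mm ℂ)ˣ) (lam : ScX d L i.mv i.kk hL × ι → ℝ) (y : (pcGeo d hL i).Site) :
    (pcFamily₁ d mm ι a₀ e c₄r β₀ hL i μ₀ E).e n U' lam y =
      (BlockNorm.ofBlocks (pcGeo d hL i) (liftBlk (scBlk d L i.mv i.kk hL ∘ kingPr L i.kk i.r (cvM d L i.mv i.kk hL)) ι)).loc y (pcOps₁ d mm ι a₀ e hL i μ₀ E n U' lam) := rfl

end Family

end Summit.QuantumFields.YangMills.BalabanUVNodes.N15.Gluing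

end
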